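import Summits.CriticalPhenomena.PercolationContinuityZ3.Theorems.PercNearOneGluingNoHeavyLowerTailSahiCombDisjunctThreeIdentities
import Summits.CriticalPhenomena.PercolationContinuityZ3.Theorems.SahiMasterFamilyPointwiseCoordinateGluing
import Summits.CriticalPhenomena.PercolationContinuityZ3.Theorems.SahiMasterFamilyComparableStep
import Literature.Combinatorics.Sahi2008.Percolation
import Literature.Probability.LatticeModels.SahiE3Reflection
import Mathlib.Tactic.Linarith
import Mathlib.Tactic.Ring
import HarnessLib

/-!
# `NoHeavyLowerTail` (crux stmt-CriticalPhenomena-4575), master-family line P1 (abstract tower): Sahi's `C_3` for the co-sunflower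
# `(B ∪ {e ∈ ω}, A ∪ {e ∈ ω}, A ∪ B)` — THEOREM, every product weight, `A, B` ARBITRARY increasing events (they may depend on `e`)

Support file (seat `prim-masterthm-p1`, gen 7; `--supports stmt-CriticalPhenomena-4575`).  No definition, no `sorry`, standard axioms.
Memo `run/shared/lean/prim/prim-masterthm/FROM-prim-masterthm-p1-g7-CLASS-TANGENT.md` §5.

CONTEXT.  Sahi's `C_3` on the CO-SUNFLOWER class `(G₂ ∪ G₃, G₁ ∪ G₃, G₁ ∪ G₂)` (`G_i` increasing; equivalently, by the reflection
`ω ↦ ωᶜ`, Kahn's Conjecture 5 on the complements of a three-petal sunflower of increasing events, the tree's `(1 + a)(ab − e₂) ≥ e₃`,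
`Literature/…/SahiSunflowerSeparation.lean`) is OPEN (`…SahiCoSunflowerTwoLevel`: conditional on a census-clean two-level law; the
counting route `SunflowerPartition.*` of prim-ineq-prove-1 / prim-l12-p2).  Proved strata so far: independent blocks (the abstract triangle,
`SahiPairInter.…_triangle`), principal CORE and two-generator core (`SunflowerPartition.PrincipalCore/TwoGenCore`, prove-1 g34), three cylinder
complements (`sahiE3_cylCompl_nonneg`), and Sahi's own class (one MEMBER a cylinder, `sahiE_bernoulliWeight_ind_nonneg_offTwo`).

THIS FILE adds the stratum "ONE GENERATOR IS A COORDINATE": with `O = {ω | e ∈ ω}`,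
* `orCoord_arith` — the EXACT one-coordinate form (a ring identity, then signs): writing `t = p_e` and, for the `e ← 0` sections, `a₀ = μ(A⁰)`, `b₀ = μ(B⁰)`,
  `c₀ = μ(A⁰ ∩ B⁰)`, `w₀ = μ(A⁰ ∪ B⁰)`, and `w₁ = μ(A¹ ∪ B¹)`:
    `E_3(μ_p; B ∪ O, A ∪ O, A ∪ B) = (1 − t)·[ t(w₁ − w₀)·K + t·c₀·(1 − w₀) + (1 − t)(c₀ − a₀b₀)(2 − w₀) ]`,
    `K = (2 − a₀ − b₀) − t(1 − a₀)(1 − b₀) − (c₀ − a₀b₀)`  (a ring identity given inclusion–exclusion `w₀ = a₀ + b₀ − c₀`);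
* **`sahiE_three_orCoord_nonneg`** — hence `E_3(μ_p; B ∪ O, A ∪ O, A ∪ B) ≥ 0` for ALL increasing `A, B` (no `e`-freeness): every bracket
  is `≥ 0` by `w₁ ≥ w₀` (sections of the increasing `A ∪ B`), `K ≥ 1 − c₀ ≥ 0`, and HARRIS for the two `0`-sections, `c₀ ≥ a₀b₀`.
  Neither member is a cylinder and `A, B` may depend on `e`, so this is not an instance of Sahi's theorem or of P2's disjunctive gluing
  `C_3(e ∨ F, g, h) ⟸ C_3(F, G₀, H₀)` (which needs `F` `e`-free).
* `sahiE3_compl_sunflower_coord_nonneg` — the reflected, sunflower-complement form: for increasing `G₁, G₂` and the cylinder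
  `C = {ω | e ∈ ω}`, the three increasing events `G₂ ∩ C, G₁ ∩ C, G₁ ∩ G₂` form a sunflower (core `G₁ ∩ G₂ ∩ C`) and
  `E_3(μ_p; (G₂ ∩ C)ᶜ, (G₁ ∩ C)ᶜ, (G₁ ∩ G₂)ᶜ) ≥ 0` — the tree's open `(1 + a)(ab − e₂) ≥ e₃` on this stratum, for every product measure.
The same two-Harris argument proves the paper statement with `C = {ω | z ⊆ ω}` any cylinder (condition on `z`; memo §5); only `|z| = 1` is
formalised here.  HONEST FRAMING: a small proved stratum; the class itself and Kahn's Conjecture 5 remain OPEN. [this work]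
-/

noncomputable section

open scoped Classical

namespace Summit.CriticalPhenomena.PercolationContinuityZ3.Theorems

namespace SahiCoSunflowerOrCoordinate

open Finset Function
open Literature.Combinatorics.Sahi2008
open Literature.Probability.LatticeModels (sahiE3 prodBernoulli)
open Literature.Probability.Percolation.DecisionTree (ind ind_of_mem ind_of_not_mem ind_nonneg)
open Literature.Probability.Percolation.BHK2006 (ind_inter)

variable {ι : Type} [Fintype ι]

/-! ### 1. The arithmetic core -/

/-- **The one-variable identity and its sign.**  With `w₀ = a + b − c` (inclusion–exclusion), the expression of
`E_3(B ∪ O, A ∪ O, A ∪ B)` in the section moments is `(1−t)·[t(w₁ − w₀)K + t c (1 − w₀) + (1−t)(c − ab)(2 − w₀)]`,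
`K = (2 − a − b) − t(1−a)(1−b) − (c − ab)`, and every bracket is nonnegative when `0 ≤ t ≤ 1`, `a, b, c ∈ [0,1]`, `w₀ ≤ 1`, `w₀ ≤ w₁`
and `ab ≤ c` (Harris). [this work] -/
theorem orCoord_arith {t a b c w₀ w₁ : ℝ} (ht0 : 0 ≤ t) (ht1 : t ≤ 1) (ha1 : a ≤ 1) (hb1 : b ≤ 1) (hc0 : 0 ≤ c)
    (hc1 : c ≤ 1) (hw1 : w₀ ≤ 1) (hw : w₀ ≤ w₁) (hH : a * b ≤ c) (hie : w₀ = a + b - c) :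
    0 ≤ 2 * (t * w₁ + (1 - t) * c) + (t + (1 - t) * b) * (t + (1 - t) * a) * (t * w₁ + (1 - t) * w₀)
      - ((t + (1 - t) * b) * (t * w₁ + (1 - t) * a) + (t + (1 - t) * a) * (t * w₁ + (1 - t) * b)
        + (t * w₁ + (1 - t) * w₀) * (t + (1 - t) * c)) := by
  have key : 2 * (t * w₁ + (1 - t) * c) + (t + (1 - t) * b) * (t + (1 - t) * a) * (t * w₁ + (1 - t) * w₀)
      - ((t + (1 - t) * b) * (t * w₁ + (1 - t) * a) + (t + (1 - t) * a) * (t * w₁ + (1 - t) * b)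
        + (t * w₁ + (1 - t) * w₀) * (t + (1 - t) * c)) =
      (1 - t) * (t * (w₁ - w₀) * ((2 - a - b) - t * ((1 - a) * (1 - b)) - (c - a * b))
        + t * c * (1 - w₀) + (1 - t) * (c - a * b) * (2 - w₀)) := by
    subst hie; ring
  rw [key]
  have hK : 0 ≤ (2 - a - b) - t * ((1 - a) * (1 - b)) - (c - a * b) := by
    nlinarith [mul_nonneg (sub_nonneg.2 ha1) (sub_nonneg.2 hb1), mul_le_mul_of_nonneg_right ht1
      (mul_nonneg (sub_nonneg.2 ha1) (sub_nonneg.2 hb1))]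
  have h1 : 0 ≤ t * (w₁ - w₀) * ((2 - a - b) - t * ((1 - a) * (1 - b)) - (c - a * b)) :=
    mul_nonneg (mul_nonneg ht0 (sub_nonneg.2 hw)) hK
  have h2 : 0 ≤ t * c * (1 - w₀) := mul_nonneg (mul_nonneg ht0 hc0) (sub_nonneg.2 hw1)
  have h3 : 0 ≤ (1 - t) * (c - a * b) * (2 - w₀) :=
    mul_nonneg (mul_nonneg (sub_nonneg.2 ht1) (sub_nonneg.2 hH)) (by linarith)
  exact mul_nonneg (sub_nonneg.2 ht1) (by linarith)

/-! ### 2. Plumbing: indicators, sections of the three events -/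

omit [Fintype ι] in
/-- Inclusion–exclusion for indicators: `1_{X ∪ Y} = 1_X + 1_Y − 1_{X ∩ Y}`. [folklore] -/
theorem ind_union_eq (X Y : Set (Set ι)) : ind (X ∪ Y) = ind X + ind Y - ind (X ∩ Y) := by
  funext ω
  simp only [Pi.add_apply, Pi.sub_apply]
  by_cases hX : ω ∈ X
  · by_cases hY : ω ∈ Y
    · rw [ind_of_mem (show ω ∈ X ∪ Y from Or.inl hX), ind_of_mem hX, ind_of_mem hY,
        ind_of_mem (show ω ∈ X ∩ Y from ⟨hX, hY⟩)]; ring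
    · rw [ind_of_mem (show ω ∈ X ∪ Y from Or.inl hX), ind_of_mem hX, ind_of_not_mem hY,
        ind_of_not_mem (show ω ∉ X ∩ Y from fun h => hY h.2)]; ring
  · by_cases hY : ω ∈ Y
    · rw [ind_of_mem (show ω ∈ X ∪ Y from Or.inr hY), ind_of_not_mem hX, ind_of_mem hY,
        ind_of_not_mem (show ω ∉ X ∩ Y from fun h => hX h.1)]; ring
    · rw [ind_of_not_mem (show ω ∉ X ∪ Y from fun h => h.elim hX hY), ind_of_not_mem hX, ind_of_not_mem hY,
        ind_of_not_mem (show ω ∉ X ∩ Y from fun h => hX h.1)]; ring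

/-- `μ_p(X ∪ Y) = μ_p(X) + μ_p(Y) − μ_p(X ∩ Y)`. [folklore] -/
theorem ex_ind_union (μ : Set ι → ℝ) (X Y : Set (Set ι)) :
    ex μ (ind (X ∪ Y)) = ex μ (ind X) + ex μ (ind Y) - ex μ (ind (X ∩ Y)) := by
  rw [ind_union_eq, SahiCombDisjunct.ex_sub', ex_add]

/-! ### 3. The theorem -/

/-- **THEOREM (co-sunflower with a coordinate generator).**  For every finite cube, every product weight `p`, every coordinate `e`
(`O = {ω | e ∈ ω}`) and ALL increasing events `A, B`:  `0 ≤ E_3(μ_p; B ∪ O, A ∪ O, A ∪ B)`.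
Proof: condition on the coordinate `e` (`ex_ind_eq_secAt`); the sections of the seven intersections are `univ`, `A¹ ∪ B¹` on the `1`-side
and `B⁰, A⁰, A⁰ ∪ B⁰, A⁰ ∩ B⁰` on the `0`-side; then `orCoord_arith` with Harris for `(A⁰, B⁰)` and `μ(A⁰ ∪ B⁰) ≤ μ(A¹ ∪ B¹)`. [this work] -/
theorem sahiE_three_orCoord_nonneg (p : ι → unitInterval) (e : ι) {A B : Set (Set ι)} (hA : IsUpperSet A)
    (hB : IsUpperSet B) :
    0 ≤ sahiE (bernoulliWeight p) 3 ![ind (B ∪ {ω : Set ι | e ∈ ω}), ind (A ∪ {ω : Set ι | e ∈ ω}), ind (A ∪ B)] := by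
  set O : Set (Set ι) := {ω : Set ι | e ∈ ω} with hO
  -- the seven events and their sections
  have sO1 : secAt e true O = Set.univ := SahiCombDisjunct.secAt_true_coord e
  have sO0 : secAt e false O = ∅ := SahiCombDisjunct.secAt_false_coord e
  set A0 := secAt e false A
  set B0 := secAt e false B
  set A1 := secAt e true A
  set B1 := secAt e true B
  -- measures as reals
  set t : ℝ := (p e : ℝ) with ht
  set μ := bernoulliWeight p with hμ
  have ht0 : 0 ≤ t := (p e).2.1
  have ht1 : t ≤ 1 := (p e).2.2
  -- (1) U₁ = B ∪ O
  have e1 : ex μ (ind (B ∪ O)) = t + (1 - t) * ex μ (ind B0) := by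
    rw [ex_ind_eq_secAt p e, SahiCombDisjunct.secAt_union, SahiCombDisjunct.secAt_union, sO1, sO0, Set.union_univ,
      Set.union_empty, SahiCombDisjunct.ex_ind_univ, mul_one]
  -- (2) U₂ = A ∪ O
  have e2 : ex μ (ind (A ∪ O)) = t + (1 - t) * ex μ (ind A0) := by
    rw [ex_ind_eq_secAt p e, SahiCombDisjunct.secAt_union, SahiCombDisjunct.secAt_union, sO1, sO0, Set.union_univ,
      Set.union_empty, SahiCombDisjunct.ex_ind_univ, mul_one]
  -- (3) U₃ = A ∪ B
  have e3 : ex μ (ind (A ∪ B)) = t * ex μ (ind (A1 ∪ B1)) + (1 - t) * ex μ (ind (A0 ∪ B0)) := by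
    rw [ex_ind_eq_secAt p e, SahiCombDisjunct.secAt_union, SahiCombDisjunct.secAt_union]
  -- (12) U₁ ∩ U₂ : sections univ / B0 ∩ A0
  have e12 : ex μ (ind ((B ∪ O) ∩ (A ∪ O))) = t + (1 - t) * ex μ (ind (A0 ∩ B0)) := by
    rw [ex_ind_eq_secAt p e, secAt_inter, secAt_inter, SahiCombDisjunct.secAt_union, SahiCombDisjunct.secAt_union,
      SahiCombDisjunct.secAt_union, SahiCombDisjunct.secAt_union, sO1, sO0, Set.union_univ, Set.union_univ,
      Set.univ_inter, Set.union_empty, Set.union_empty, SahiCombDisjunct.ex_ind_univ, Set.inter_comm B0 A0, mul_one]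
  -- (13) U₁ ∩ U₃ : sections A1 ∪ B1 / B0
  have e13 : ex μ (ind ((B ∪ O) ∩ (A ∪ B))) = t * ex μ (ind (A1 ∪ B1)) + (1 - t) * ex μ (ind B0) := by
    rw [ex_ind_eq_secAt p e, secAt_inter, secAt_inter, SahiCombDisjunct.secAt_union, SahiCombDisjunct.secAt_union,
      SahiCombDisjunct.secAt_union, SahiCombDisjunct.secAt_union, sO1, sO0, Set.union_univ, Set.univ_inter,
      Set.union_empty, Set.inter_eq_left.2 Set.subset_union_right]
  -- (23) U₂ ∩ U₃ : sections A1 ∪ B1 / A0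
  have e23 : ex μ (ind ((A ∪ O) ∩ (A ∪ B))) = t * ex μ (ind (A1 ∪ B1)) + (1 - t) * ex μ (ind A0) := by
    rw [ex_ind_eq_secAt p e, secAt_inter, secAt_inter, SahiCombDisjunct.secAt_union, SahiCombDisjunct.secAt_union,
      SahiCombDisjunct.secAt_union, SahiCombDisjunct.secAt_union, sO1, sO0, Set.union_univ, Set.univ_inter,
      Set.union_empty, Set.inter_eq_left.2 Set.subset_union_left]
  -- (123) : sections A1 ∪ B1 / A0 ∩ B0
  have e123 : ex μ (ind ((B ∪ O) ∩ (A ∪ O) ∩ (A ∪ B))) = t * ex μ (ind (A1 ∪ B1)) + (1 - t) * ex μ (ind (A0 ∩ B0)) := by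
    rw [ex_ind_eq_secAt p e, secAt_inter, secAt_inter, secAt_inter, secAt_inter, SahiCombDisjunct.secAt_union,
      SahiCombDisjunct.secAt_union, SahiCombDisjunct.secAt_union, SahiCombDisjunct.secAt_union,
      SahiCombDisjunct.secAt_union, SahiCombDisjunct.secAt_union, sO1, sO0, Set.union_univ, Set.union_univ,
      Set.univ_inter, Set.univ_inter, Set.union_empty, Set.union_empty, Set.inter_comm B0 A0,
      Set.inter_eq_left.2 (Set.inter_subset_left.trans Set.subset_union_left)]
  -- the ingredients of `orCoord_arith`
  have hH : ex μ (ind A0) * ex μ (ind B0) ≤ ex μ (ind (A0 ∩ B0)) :=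
    harris_ex_ind p (isUpperSet_secAt e false hA) (isUpperSet_secAt e false hB)
  have hw : ex μ (ind (A0 ∪ B0)) ≤ ex μ (ind (A1 ∪ B1)) := by
    have h := Pointwise.ex_secAt_true_sub_false_nonneg p e (hA.union hB)
    rw [SahiCombDisjunct.secAt_union, SahiCombDisjunct.secAt_union] at h
    linarith
  have hie : ex μ (ind (A0 ∪ B0)) = ex μ (ind A0) + ex μ (ind B0) - ex μ (ind (A0 ∩ B0)) := ex_ind_union μ A0 B0
  -- assemble
  rw [sahiE_three]
  simp only [ind_mul_ind_eq_inter]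
  rw [e1, e2, e3, e12, e13, e23, e123]
  exact orCoord_arith ht0 ht1 (ex_bernoulliWeight_ind_le_one p A0) (ex_bernoulliWeight_ind_le_one p B0) (ex_ind_nonneg' p _)
    (ex_bernoulliWeight_ind_le_one p _) (ex_bernoulliWeight_ind_le_one p _) hw hH hie

/-! ### 4. The sunflower-complement (reflected) form -/

/-- **Kahn's Conjecture 5 on the complements of the sunflower `(G₂ ∩ C, G₁ ∩ C, G₁ ∩ G₂)`, `C = {e ∈ ω}` a one-coordinate cylinder,
`G₁, G₂` arbitrary increasing events**: `0 ≤ E_3(μ_p; (G₂ ∩ C)ᶜ, (G₁ ∩ C)ᶜ, (G₁ ∩ G₂)ᶜ)` for every product measure — the tree's open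
`(1 + a)(ab − e₂) ≥ e₃` (`sahiE3_compl_sunflower_eq`) on this stratum.  Proof: reflection `ω ↦ ωᶜ`, `p ↦ 1 − p`
(`sahiE3_eq_sahiE3_preimage_compl`) turns the three complements into `B ∪ O, A ∪ O, A ∪ B` with `A, B` the reflected complements
of `G₁, G₂` (increasing) and `O = {e ∈ ω}`; then `sahiE_three_orCoord_nonneg`. [this work] -/
theorem sahiE3_compl_sunflower_coord_nonneg (p : ι → unitInterval) (e : ι) {G₁ G₂ : Set (Set ι)} (h₁ : IsUpperSet G₁)
    (h₂ : IsUpperSet G₂) :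
    0 ≤ sahiE3 (prodBernoulli p) (G₂ ∩ {ω : Set ι | e ∈ ω})ᶜ (G₁ ∩ {ω : Set ι | e ∈ ω})ᶜ (G₁ ∩ G₂)ᶜ := by
  rw [Literature.Probability.LatticeModels.sahiE3_eq_sahiE3_preimage_compl p MeasurableSet.of_discrete MeasurableSet.of_discrete
    MeasurableSet.of_discrete, Set.preimage_compl, Set.preimage_compl, Set.preimage_compl, Set.preimage_inter,
    Set.preimage_inter, Set.preimage_inter, Set.compl_inter, Set.compl_inter, Set.compl_inter, ← sahiE_three_ind]
  have hO : (compl ⁻¹' {ω : Set ι | e ∈ ω})ᶜ = {ω : Set ι | e ∈ ω} := by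
    ext ω; simp
  rw [hO]
  exact sahiE_three_orCoord_nonneg _ e (Literature.Probability.LatticeModels.isLowerSet_preimage_compl h₁).compl
    (Literature.Probability.LatticeModels.isLowerSet_preimage_compl h₂).compl

end SahiCoSunflowerOrCoordinate

end Summit.CriticalPhenomena.PercolationContinuityZ3.Theorems
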